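import Summits.FinalStateConjecture.FinalStateConjecture.Theorems.UniformPhotonSphereChannels.Negative.ApproxConservation

/-!
# Crux `UniformPhotonSphereChannels` (K1), negative side — the commuted-energy bound

Support file of the standing disprover of item stmt-FinalStateConjecture-10045 (rest-packet pinning,
step 2).  In the pinning set-up of `ApproxConservation` (a `C³` solution `u` of
`u_tt − u_xx + W u = 0`, data supported in `[Xl, Xr]`, `W ≥ W_min > 0` and `|∂W| ≤ D` on the
solid influence region up to time `T₁`), the energy `E₁` of the commuted field `v = ∂ₓu` — which
solves `v_tt − v_xx + W v = −(∂ₓW) u` (`CommutedField`) — satisfies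

`E₁(T) ≤ 2 E₁(0) + 16 T₁² D² E(0) / W_min`   on `[0, T₁]`, provided `T₁ D ≤ W_min / 4`

(`commutedEnergy_le`; AM–GM with weight `1/4T₁`, the energy bound `E ≤ 2E(0)` and the
bootstrap).  Since `E₁ ≥ W_min ∫ u_x²`, this pins `‖u_x‖_{L²}`: for fixed data and `W_min → ∞`
(large angular momentum) the packet cannot acquire spatial momentum. [folklore]
-/

namespace Summit.FinalStateConjecture.FinalStateConjecture.Theorems

open MeasureTheory Set Filter Topology intervalIntegral

noncomputable section

namespace WaveDefect

open WaveEnergy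

variable {u W : ℝ × ℝ → ℝ} {Xl Xr : ℝ}

/-- **Commuted-energy bound.** See the module docstring. -/
theorem commutedEnergy_le (hu : ContDiff ℝ 3 u) (hW : ContDiff ℝ 1 W) (hW0 : ∀ z, 0 ≤ W z)
    (hsol : ∀ z : ℝ × ℝ, fderiv ℝ (fderiv ℝ u) z (1, 0) (1, 0)
      - fderiv ℝ (fderiv ℝ u) z (0, 1) (0, 1) + W z * u z = 0)
    (hzeroL : ∀ z : ℝ × ℝ, z.2 + |z.1| < Xl → u z = 0)
    (hzeroR : ∀ z : ℝ × ℝ, Xr < z.2 - |z.1| → u z = 0)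
    (hX : Xl ≤ Xr) {T₁ Wmin D : ℝ} (hT₁ : 0 < T₁) (hWmin : 0 < Wmin) (hD : 0 ≤ D)
    (hWK : ∀ z : ℝ × ℝ, z.1 ∈ Icc 0 T₁ → Xl - z.1 ≤ z.2 → z.2 ≤ Xr + z.1 → Wmin ≤ W z)
    (hDK : ∀ z : ℝ × ℝ, z.1 ∈ Icc 0 T₁ → Xl - z.1 ≤ z.2 → z.2 ≤ Xr + z.1 → |fderiv ℝ W z (1, 0)| ≤ D)
    (hDXK : ∀ z : ℝ × ℝ, z.1 ∈ Icc 0 T₁ → Xl - z.1 ≤ z.2 → z.2 ≤ Xr + z.1 → |fderiv ℝ W z (0, 1)| ≤ D)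
    (hsmall : T₁ * D ≤ Wmin / 4)
    {e e₁ : ℝ × ℝ → ℝ}
    (he : ∀ z, e z = (fderiv ℝ u z (1, 0)) ^ 2 + (fderiv ℝ u z (0, 1)) ^ 2 + W z * u z ^ 2)
    (he₁ : ∀ z, e₁ z = (fderiv ℝ (fun w => fderiv ℝ u w (0, 1)) z (1, 0)) ^ 2
      + (fderiv ℝ (fun w => fderiv ℝ u w (0, 1)) z (0, 1)) ^ 2
      + W z * (fderiv ℝ u z (0, 1)) ^ 2) :
    ∀ T ∈ Icc 0 T₁, (∫ X in (Xl - T₁ - 1)..(Xr + T₁ + 1), e₁ (T, X))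
      ≤ 2 * (∫ X in (Xl - T₁ - 1)..(Xr + T₁ + 1), e₁ (0, X))
        + 16 * T₁ ^ 2 * D ^ 2 * (∫ X in (Xl - T₁ - 1)..(Xr + T₁ + 1), e (0, X)) / Wmin := by
  have hu2 : ContDiff ℝ 2 u := hu.of_le (by norm_num)
  set v : ℝ × ℝ → ℝ := fun w => fderiv ℝ u w (0, 1) with hvdef
  have hv2 : ContDiff ℝ 2 v := contDiff_two_fderiv_apply hu (0, 1)
  set A : ℝ := Xl - T₁ - 1 with hA
  set B : ℝ := Xr + T₁ + 1 with hB
  have hAB : A ≤ B := by rw [hA, hB]; linarith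
  set m₁ : ℝ × ℝ → ℝ := fun z => 2 * fderiv ℝ v z (1, 0) * fderiv ℝ v z (0, 1) with hm₁def
  have hm₁ : ∀ z, m₁ z = 2 * fderiv ℝ v z (1, 0) * fderiv ℝ v z (0, 1) := fun z => rfl
  set F₁ : ℝ × ℝ → ℝ := fun z => fderiv ℝ (fderiv ℝ v) z (1, 0) (1, 0)
      - fderiv ℝ (fderiv ℝ v) z (0, 1) (0, 1) + W z * v z with hF₁def
  have hF₁ : ∀ z, F₁ z = fderiv ℝ (fderiv ℝ v) z (1, 0) (1, 0)
      - fderiv ℝ (fderiv ℝ v) z (0, 1) (0, 1) + W z * v z := fun z => rfl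
  have hF₁G : ∀ z, F₁ z = -(fderiv ℝ W z (0, 1) * u z) := fun z => defect_fderiv_snd hu hW hsol z
  have he₁' : ∀ z, e₁ z = (fderiv ℝ v z (1, 0)) ^ 2 + (fderiv ℝ v z (0, 1)) ^ 2 + W z * v z ^ 2 :=
    fun z => he₁ z
  have he₁c : Continuous e₁ := (differentiable_energyDensity hv2 (hW.differentiable (by norm_num)) he₁').continuous
  have he₁0 : ∀ z, 0 ≤ e₁ z := energyDensity_nonneg hW0 he₁'
  have he0 : ∀ z, 0 ≤ e z := energyDensity_nonneg hW0 he
  have hec : Continuous e := (differentiable_energyDensity hu2 (hW.differentiable (by norm_num)) he).continuous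
  set E₁ : ℝ → ℝ := fun T => ∫ X in A..B, e₁ (T, X) with hE₁
  set E : ℝ → ℝ := fun T => ∫ X in A..B, e (T, X) with hE
  have hE₁c : Continuous E₁ :=
    intervalIntegral.continuous_parametric_intervalIntegral_of_continuous' (f := fun T X => e₁ (T, X))
      (show Continuous fun p : ℝ × ℝ => e₁ (p.1, p.2) from
        he₁c.comp (continuous_fst.prodMk continuous_snd)) A B
  -- the energy bound for `u`
  have hEb : ∀ t ∈ Icc 0 T₁, E t ≤ 2 * E 0 :=
    energy_le_two_mul hu hW hW0 hsol hzeroL hzeroR hX hT₁ hWmin hD hWK hDK (by linarith) he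
  -- vanishing of `v` and its partials outside the influence region
  have hvzeroL : ∀ z : ℝ × ℝ, z.2 + |z.1| < Xl → v z = 0 ∧ fderiv ℝ v z = 0 := by
    intro z hz
    obtain ⟨-, h1, h2⟩ := vanish_left hzeroL hz
    exact ⟨by rw [hvdef]; simp only [h1]; rfl, h2 (0, 1)⟩
  have hvzeroR : ∀ z : ℝ × ℝ, Xr < z.2 - |z.1| → v z = 0 ∧ fderiv ℝ v z = 0 := by
    intro z hz
    obtain ⟨-, h1, h2⟩ := vanish_right hzeroR hz
    exact ⟨by rw [hvdef]; simp only [h1]; rfl, h2 (0, 1)⟩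
  have hbdA : ∀ t ∈ Icc 0 T₁, m₁ (t, A) = 0 := by
    intro t ht
    have hz : (t, A).2 + |(t, A).1| < Xl := by
      simp only; rw [abs_of_nonneg ht.1, hA]; linarith [ht.2]
    simp [hm₁, (hvzeroL _ hz).2]
  have hbdB : ∀ t ∈ Icc 0 T₁, m₁ (t, B) = 0 := by
    intro t ht
    have hz : Xr < (t, B).2 - |(t, B).1| := by
      simp only; rw [abs_of_nonneg ht.1, hB]; linarith [ht.2]
    simp [hm₁, (hvzeroR _ hz).2]
  -- the AM–GM weight
  set lam : ℝ := 1 / (4 * T₁) with hlam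
  have hlam0 : 0 < lam := by rw [hlam]; positivity
  -- pointwise source bound
  have hsrc : ∀ t ∈ Icc 0 T₁, ∀ X, 2 * fderiv ℝ v (t, X) (1, 0) * F₁ (t, X)
      + fderiv ℝ W (t, X) (1, 0) * v (t, X) ^ 2
      ≤ (lam + D / Wmin) * e₁ (t, X) + D ^ 2 / (lam * Wmin) * e (t, X) := by
    intro t ht X
    rw [hF₁G]
    by_cases hK : Xl - t ≤ X ∧ X ≤ Xr + t
    · have hW1 := hWK (t, X) ht hK.1 hK.2
      have hD1 := hDK (t, X) ht hK.1 hK.2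
      have hD2 := hDXK (t, X) ht hK.1 hK.2
      -- abbreviations
      set a := fderiv ℝ v (t, X) (1, 0) with ha
      set b := fderiv ℝ W (t, X) (0, 1) * u (t, X) with hb
      have hvt : a ^ 2 ≤ e₁ (t, X) := by
        rw [he₁']
        nlinarith [sq_nonneg (fderiv ℝ v (t, X) (0, 1)), mul_nonneg (hW0 (t, X)) (sq_nonneg (v (t, X)))]
      have hv2' : Wmin * v (t, X) ^ 2 ≤ e₁ (t, X) := by
        rw [he₁']
        nlinarith [sq_nonneg (fderiv ℝ v (t, X) (1, 0)), sq_nonneg (fderiv ℝ v (t, X) (0, 1)),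
          mul_le_mul_of_nonneg_right hW1 (sq_nonneg (v (t, X)))]
      have hu2' : Wmin * u (t, X) ^ 2 ≤ e (t, X) := by
        rw [he]
        nlinarith [sq_nonneg (fderiv ℝ u (t, X) (1, 0)), sq_nonneg (fderiv ℝ u (t, X) (0, 1)),
          mul_le_mul_of_nonneg_right hW1 (sq_nonneg (u (t, X)))]
      -- AM–GM: `2 a (−b) ≤ lam a² + b²/lam`
      have hamgm : 2 * a * -b ≤ lam * a ^ 2 + b ^ 2 / lam := by
        have h := sq_nonneg (lam * a + b)
        have hl : lam * a ^ 2 + b ^ 2 / lam - 2 * a * -b = (lam * a + b) ^ 2 / lam := by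
          field_simp
          ring
        have : 0 ≤ (lam * a + b) ^ 2 / lam := div_nonneg h hlam0.le
        linarith
      -- `b² ≤ D² u² ≤ D²/Wmin · e`
      have hb2 : b ^ 2 ≤ D ^ 2 / Wmin * e (t, X) := by
        have h1 : b ^ 2 ≤ D ^ 2 * u (t, X) ^ 2 := by
          rw [hb, mul_pow]
          exact mul_le_mul_of_nonneg_right (sq_le_sq' (by linarith [abs_le.mp hD2]) (abs_le.mp hD2).2) (sq_nonneg _)
        have h2 : D ^ 2 * u (t, X) ^ 2 ≤ D ^ 2 / Wmin * e (t, X) := by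
          rw [div_mul_eq_mul_div, le_div_iff₀ hWmin]
          nlinarith [mul_le_mul_of_nonneg_left hu2' (sq_nonneg D)]
        linarith
      have hWt : fderiv ℝ W (t, X) (1, 0) * v (t, X) ^ 2 ≤ D / Wmin * e₁ (t, X) := by
        have h1 : fderiv ℝ W (t, X) (1, 0) * v (t, X) ^ 2 ≤ D * v (t, X) ^ 2 :=
          mul_le_mul_of_nonneg_right (le_of_abs_le hD1) (sq_nonneg _)
        have h2 : D * v (t, X) ^ 2 ≤ D / Wmin * e₁ (t, X) := by
          rw [div_mul_eq_mul_div, le_div_iff₀ hWmin]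
          nlinarith [mul_le_mul_of_nonneg_left hv2' hD]
        linarith
      have h3 : b ^ 2 / lam ≤ D ^ 2 / (lam * Wmin) * e (t, X) := by
        rw [div_le_iff₀ hlam0]
        have : D ^ 2 / (lam * Wmin) * e (t, X) * lam = D ^ 2 / Wmin * e (t, X) := by
          field_simp
        rw [this]
        exact hb2
      have h4 : lam * a ^ 2 ≤ lam * e₁ (t, X) := mul_le_mul_of_nonneg_left hvt hlam0.le
      calc 2 * a * -b + fderiv ℝ W (t, X) (1, 0) * v (t, X) ^ 2
          ≤ (lam * a ^ 2 + b ^ 2 / lam) + D / Wmin * e₁ (t, X) := add_le_add hamgm hWt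
        _ ≤ (lam * e₁ (t, X) + D ^ 2 / (lam * Wmin) * e (t, X)) + D / Wmin * e₁ (t, X) := by
            linarith
        _ = (lam + D / Wmin) * e₁ (t, X) + D ^ 2 / (lam * Wmin) * e (t, X) := by ring
    · have hzz : v (t, X) = 0 ∧ fderiv ℝ v (t, X) = 0 := by
        rcases not_and_or.mp hK with h | h
        · push Not at h
          exact hvzeroL (t, X) (by simp only; rw [abs_of_nonneg ht.1]; linarith)
        · push Not at h
          exact hvzeroR (t, X) (by simp only; rw [abs_of_nonneg ht.1]; linarith)
      rw [hzz.1, hzz.2]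
      have : 0 ≤ (lam + D / Wmin) * e₁ (t, X) + D ^ 2 / (lam * Wmin) * e (t, X) := by
        have := he₁0 (t, X); have := he0 (t, X); positivity
      simpa using this
  -- the integral inequality
  have hineq : ∀ T ∈ Icc 0 T₁, E₁ T ≤ (E₁ 0 + 2 * T₁ * (D ^ 2 / (lam * Wmin)) * E 0)
      + (lam + D / Wmin) * ∫ t in (0 : ℝ)..T, E₁ t := by
    intro T hT
    have key := energy_identity_affine_source hv2 hW he₁' hm₁ hF₁ A 0 B 0 0 T
    simp only [zero_mul, add_zero] at key
    have hbd : (∫ t in (0 : ℝ)..T, (m₁ (t, B) - m₁ (t, A))) = 0 := by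
      refine (intervalIntegral.integral_congr (g := fun _ => (0 : ℝ)) fun t ht => ?_).trans (by simp)
      rw [uIcc_of_le hT.1] at ht
      have ht' : t ∈ Icc 0 T₁ := ⟨ht.1, ht.2.trans hT.2⟩
      simp [hbdA t ht', hbdB t ht']
    rw [hbd, zero_add] at key
    -- continuity of the source integrand
    have hsc : Continuous fun p : ℝ × ℝ => 2 * fderiv ℝ v p (1, 0) * F₁ p + fderiv ℝ W p (1, 0) * v p ^ 2 := by
      have h1 := continuous_fderiv_apply hv2 (1, 0)
      have h2 := continuous_defect hv2 hW.continuous hF₁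
      have h3 : Continuous fun p : ℝ × ℝ => fderiv ℝ W p (1, 0) :=
        (hW.continuous_fderiv (by norm_num)).clm_apply continuous_const
      exact ((continuous_const.mul h1).mul h2).add (h3.mul (hv2.continuous.pow 2))
    have hsrc_int : (∫ t in (0 : ℝ)..T, ∫ X in A..B,
        (2 * fderiv ℝ v (t, X) (1, 0) * F₁ (t, X) + fderiv ℝ W (t, X) (1, 0) * v (t, X) ^ 2))
        ≤ ∫ t in (0 : ℝ)..T, ((lam + D / Wmin) * E₁ t + D ^ 2 / (lam * Wmin) * E t) := by
      refine intervalIntegral.integral_mono_on hT.1 ?_ ?_ fun t ht => ?_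
      · exact (intervalIntegral.continuous_parametric_intervalIntegral_of_continuous'
          (f := fun t X => 2 * fderiv ℝ v (t, X) (1, 0) * F₁ (t, X) + fderiv ℝ W (t, X) (1, 0) * v (t, X) ^ 2)
          (show Continuous fun p : ℝ × ℝ => 2 * fderiv ℝ v (p.1, p.2) (1, 0) * F₁ (p.1, p.2)
              + fderiv ℝ W (p.1, p.2) (1, 0) * v (p.1, p.2) ^ 2 from
            hsc.comp (continuous_fst.prodMk continuous_snd)) A B).intervalIntegrable _ _
      · have hEc : Continuous E :=
          intervalIntegral.continuous_parametric_intervalIntegral_of_continuous' (f := fun T X => e (T, X))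
            (show Continuous fun p : ℝ × ℝ => e (p.1, p.2) from
              hec.comp (continuous_fst.prodMk continuous_snd)) A B
        exact ((continuous_const.mul hE₁c).add (continuous_const.mul hEc)).intervalIntegrable _ _
      · have ht' : t ∈ Icc 0 T₁ := ⟨ht.1, ht.2.trans hT.2⟩
        rw [hE₁, hE]
        simp only
        rw [← intervalIntegral.integral_const_mul, ← intervalIntegral.integral_const_mul,
          ← intervalIntegral.integral_add]
        · refine intervalIntegral.integral_mono_on hAB ?_ ?_ fun X _ => hsrc t ht' X
          · exact (hsc.comp (Continuous.prodMk_right t)).intervalIntegrable _ _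
          · exact ((continuous_const.mul (he₁c.comp (Continuous.prodMk_right t))).add
              (continuous_const.mul (hec.comp (Continuous.prodMk_right t)))).intervalIntegrable _ _
        · exact (continuous_const.mul (he₁c.comp (Continuous.prodMk_right t))).intervalIntegrable _ _
        · exact (continuous_const.mul (hec.comp (Continuous.prodMk_right t))).intervalIntegrable _ _
    -- split and bound the `E` part by `2 E 0`
    have hsplit : ∫ t in (0 : ℝ)..T, ((lam + D / Wmin) * E₁ t + D ^ 2 / (lam * Wmin) * E t)
        = (lam + D / Wmin) * (∫ t in (0 : ℝ)..T, E₁ t)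
          + D ^ 2 / (lam * Wmin) * ∫ t in (0 : ℝ)..T, E t := by
      have hEc : Continuous E :=
        intervalIntegral.continuous_parametric_intervalIntegral_of_continuous' (f := fun T X => e (T, X))
          (show Continuous fun p : ℝ × ℝ => e (p.1, p.2) from
            hec.comp (continuous_fst.prodMk continuous_snd)) A B
      have i1 : IntervalIntegrable (fun t => (lam + D / Wmin) * E₁ t) volume 0 T := by
        exact (continuous_const.mul hE₁c).intervalIntegrable _ _
      have i2 : IntervalIntegrable (fun t => D ^ 2 / (lam * Wmin) * E t) volume 0 T := by
        exact (continuous_const.mul hEc).intervalIntegrable _ _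
      rw [intervalIntegral.integral_add i1 i2,
        intervalIntegral.integral_const_mul, intervalIntegral.integral_const_mul]
    have hEint : ∫ t in (0 : ℝ)..T, E t ≤ 2 * T₁ * E 0 := by
      have hEc : Continuous E :=
        intervalIntegral.continuous_parametric_intervalIntegral_of_continuous' (f := fun T X => e (T, X))
          (show Continuous fun p : ℝ × ℝ => e (p.1, p.2) from
            hec.comp (continuous_fst.prodMk continuous_snd)) A B
      have h1 : ∫ t in (0 : ℝ)..T, E t ≤ ∫ t in (0 : ℝ)..T, 2 * E 0 :=
        intervalIntegral.integral_mono_on hT.1 (hEc.intervalIntegrable _ _) _root_.intervalIntegrable_const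
          fun t ht => hEb t ⟨ht.1, ht.2.trans hT.2⟩
      rw [intervalIntegral.integral_const, smul_eq_mul, sub_zero] at h1
      have hE00 : 0 ≤ E 0 := intervalIntegral.integral_nonneg hAB fun X _ => he0 _
      nlinarith [hT.2, hT.1]
    have hcoef : 0 ≤ D ^ 2 / (lam * Wmin) := by positivity
    have : E₁ T - E₁ 0 = ∫ t in (0 : ℝ)..T, ∫ X in A..B,
        (2 * fderiv ℝ v (t, X) (1, 0) * F₁ (t, X) + fderiv ℝ W (t, X) (1, 0) * v (t, X) ^ 2) := key
    nlinarith [mul_le_mul_of_nonneg_left hEint hcoef, hsrc_int, hsplit]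
  -- bootstrap
  have hE₁0' : ∀ T ∈ Icc 0 T₁, 0 ≤ E₁ T := fun T _ =>
    intervalIntegral.integral_nonneg hAB fun X _ => he₁0 _
  have hk : 0 ≤ lam + D / Wmin := by positivity
  have hkT : (lam + D / Wmin) * T₁ ≤ 1 / 2 := by
    rw [hlam, add_mul, div_mul_eq_mul_div, div_mul_eq_mul_div, one_mul]
    have h1 : T₁ / (4 * T₁) = 1 / 4 := by field_simp
    have h2 : D * T₁ / Wmin ≤ 1 / 4 := by rw [div_le_iff₀ hWmin]; linarith
    linarith
  have hboot := bootstrap_le_two_mul hT₁.le hE₁c.continuousOn hE₁0' hk hkT hineq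
  intro T hT
  have h := hboot T hT
  have hlam' : 2 * T₁ * (D ^ 2 / (lam * Wmin)) = 8 * T₁ ^ 2 * D ^ 2 / Wmin := by
    rw [hlam]; field_simp; ring
  rw [hlam'] at h
  have hE0def : E 0 = ∫ X in A..B, e (0, X) := rfl
  have hE₁0def : E₁ 0 = ∫ X in A..B, e₁ (0, X) := rfl
  calc E₁ T ≤ 2 * (E₁ 0 + 8 * T₁ ^ 2 * D ^ 2 / Wmin * E 0) := h
    _ = 2 * (∫ X in A..B, e₁ (0, X)) + 16 * T₁ ^ 2 * D ^ 2 * (∫ X in A..B, e (0, X)) / Wmin := by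
        rw [hE0def, hE₁0def]; ring

end WaveDefect

end

end Summit.FinalStateConjecture.FinalStateConjecture.Theorems
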